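import Summits.Ventures.LatticeQCDFlow.Scoring.BlockFactorSecondMoments
import Summits.Ventures.LatticeQCDFlow.Scoring.CharFunArgumentContinuity
import Literature.Probability.Distributions.GaussianL2Limit

/-!
# THE CENTRAL LIMIT THEOREM FOR BLOCK FACTORS OF AN I.I.D. SEQUENCE (the `m`-dependent CLT): `(√N)⁻¹ Σ_{i<N} (X_i − μ) ⇒ N(0, σ²)`, `σ² = γ(0) + 2 Σ_{t=1}^{m} γ(t)`

HONEST FRAMING: exact (Metropolis-corrected) sampling algorithms for lattice gauge theory;
figures of merit are autocorrelation/cost numbers at stated couplings and volumes; no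
continuum-physics claim.

Venture `LatticeQCDFlow` (cell pub-lqcd), sub-topic `Scoring`; FANOUT row 16 (`su2-base`, the
4D SU(2) baselines), GEN-7.  NEW WORK of the cell — our formalisation of a classical theorem that is
not in Mathlib (Mathlib has the i.i.d. CLT only, `ProbabilityTheory.tendstoInDistribution_inv_sqrt_mul_sum_sub`,
which is the engine here) — over `Scoring/BlockFactorProcess`, `Scoring/BlockFactorSecondMoments`,
row 4's `Scoring/CharFunArgumentContinuity` (characteristic functions along convergent arguments)
and the Literature's `norm_charFun_map_sub_le` (`‖φ_Z(u) − φ_W(u)‖ ≤ |u| E|Z − W|`); no definition;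
nothing is cited as a fact.  Printed counterparts NAMED ONLY: Hoeffding–Robbins, Duke Math. J. 15
(1948) 773–780 (the `m`-dependent CLT); Diananda, Proc. Camb. Phil. Soc. 51 (1955); Lehmann,
*Elements of Large-Sample Theory* (1999) Thm 2.8.1 with eq. (2.8.6) (held, p. 93 — the Bernstein
big-block/small-block proof given there defers the interchange of the two limits to Anderson 1971
§7.7; here it is closed at the level of characteristic functions); Brockwell–Davis 1991 Thm 6.4.2.

Third file of the LAW-OF-THE-ERROR packet.  Why row 16 needs it: the acceptance 'errors on τ_int
≤ 15 %' is a statement about the sampling distribution of lag-product statistics `Γ̂_N(t)`, which —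
for a finite-range (moving-average) model of the data — are normalised sums of a BLOCK-FACTOR
process; GEN-6 computed their variances (Bartlett's formula); the Gaussian LAW behind an error bar is
this theorem (applied in the companion `LagProductCLT`).

## The proof (Bernstein blocks, all limits at the level of characteristic functions)

Fix `u`.  For a big-block length `k ≥ m ⊔ 1` and period `p = k + m`, split `Σ_{i<N}(X_i − μ)` into
`⌊N/p⌋` big blocks `U_j` (i.i.d., centred, variance `v(k)`), `⌊N/p⌋` small blocks and a remainder
(`BlockFactorSecondMoments.cblockSum_decomposition`).  (1) `norm_charFun_sub_charFun_bigBlocks_le`: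
`‖φ_{S_N/√N}(u) − φ_{ΣU/√N}(u)‖ ≤ |u|(√(v(m)/p) + √(Σ_{r<p} v(r)/N))` (charFun is `|u|`-Lipschitz in
`L¹`; small blocks and remainder are small in `L²`).  (2) `tendsto_charFun_bigBlocks`:
`φ_{ΣU/√N}(u) → exp(−(v(k)/p)u²/2)` — Mathlib's CLT for `(U_j)` read along `n = ⌊N/p⌋ → ∞`, the factor
`√(⌊N/p⌋/N) → 1/√p` handled by the convergence of characteristic functions along convergent
arguments.  (3) `v(k)/(k+m) → σ²` and `√(v(m)/p) → 0` as `k → ∞`; the elementary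
`tendsto_of_forall_approx` closes the double limit, and Lévy's continuity theorem
(`ProbabilityMeasure.tendsto_iff_tendsto_charFun`) converts `φ_{S_N/√N}(u) → exp(−σ²u²/2)` into
convergence in distribution.

## Contents

* `tendsto_of_forall_approx`, `tendsto_nat_div_div` (`⌊N/p⌋/N → 1/p`),
  `charFun_gaussianReal_zero_mean`, `tendsto_cexp_neg_mul_sq` — elementary;
* **`norm_charFun_sub_charFun_bigBlocks_le`**, **`tendsto_charFun_bigBlocks`** — steps (1), (2);
* **`tendstoInDistribution_blockFactor`** — THE THEOREM: for `ξ` i.i.d., `F` measurable,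
  `X_0 ∈ L²`, and every `Y` with law `gaussianReal 0 σ²` (`σ² = lrVar γ m ≥ 0`):
  `TendstoInDistribution (fun N ω => (√N)⁻¹ Σ_{i<N} (X_i ω − E X_0)) atTop Y (fun _ => P) P'`;
  `tendstoInDistribution_blockFactor_mean` — the same as `√N (x̄_N − E X_0) ⇒ Y`.

NOT CLAIMED: a rate (Berry–Esseen); `σ² > 0` (when `σ² = 0` the statement is convergence to the
point mass, and holds); general strongly mixing or non-functional `m`-dependent sequences;
infinite-range linear processes (`MA(∞)` needs one more truncation); vector-valued `F` (obtained in
`LagProductCLT` by Cramér–Wold, not here).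
-/

noncomputable section

open MeasureTheory ProbabilityTheory Filter Finset Complex
open scoped Topology NNReal

namespace Summit.Ventures.LatticeQCDFlow.Scoring

/-! ## Three elementary lemmas -/

section Elementary

/-- **Closing a double limit**: if for every `ε > 0` the sequence `f` is eventually `ε`-close to a
sequence converging to an `ε`-neighbour of `L`, then `f → L`. -/
theorem tendsto_of_forall_approx {f : ℕ → ℂ} {L : ℂ}
    (h : ∀ ε > 0, ∃ g : ℕ → ℂ, ∃ L' : ℂ,
      Tendsto g atTop (𝓝 L') ∧ ‖L' - L‖ < ε ∧ ∀ᶠ N in atTop, ‖f N - g N‖ < ε) :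
    Tendsto f atTop (𝓝 L) := by
  rw [Metric.tendsto_atTop]
  intro ε hε
  obtain ⟨g, L', hg, hL', hfg⟩ := h (ε / 3) (by positivity)
  have hg' := (Metric.tendsto_atTop.1 hg) (ε / 3) (by positivity)
  obtain ⟨N₁, hN₁⟩ := hg'
  obtain ⟨N₂, hN₂⟩ := eventually_atTop.1 hfg
  refine ⟨max N₁ N₂, fun N hN => ?_⟩
  have h1 := hN₁ N (le_of_max_le_left hN)
  have h2 := hN₂ N (le_of_max_le_right hN)
  rw [dist_eq_norm] at h1 ⊢
  calc ‖f N - L‖ = ‖(f N - g N) + (g N - L') + (L' - L)‖ := by ring_nf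
    _ ≤ ‖f N - g N‖ + ‖g N - L'‖ + ‖L' - L‖ := norm_add₃_le
    _ < ε / 3 + ε / 3 + ε / 3 := by gcongr
    _ = ε := by ring

/-- `⌊N/p⌋ / N → 1/p` along the naturals (`p ≠ 0`). -/
theorem tendsto_nat_div_div {p : ℕ} (hp : p ≠ 0) :
    Tendsto (fun N : ℕ => ((N / p : ℕ) : ℝ) / N) atTop (𝓝 ((p : ℝ)⁻¹)) := by
  have h := (tendsto_nat_floor_mul_div_atTop (R := ℝ) (a := (p : ℝ)⁻¹) (by positivity)).comp
    tendsto_natCast_atTop_atTop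
  refine h.congr fun N => ?_
  simp only [Function.comp_apply]
  rw [inv_mul_eq_div, Nat.floor_div_eq_div]

/-- The characteristic function of a centred real Gaussian: `φ(u) = exp(−v u²/2)`. -/
theorem charFun_gaussianReal_zero_mean (v : ℝ≥0) (u : ℝ) :
    charFun (gaussianReal 0 v) u = cexp (-(((v : ℝ) * u ^ 2 / 2 : ℝ) : ℂ)) := by
  rw [charFun_gaussianReal]
  congr 1
  push_cast
  ring

/-- `x ↦ exp(−x u²/2)` is continuous along any convergent real sequence (as a complex number). -/
theorem tendsto_cexp_neg_mul_sq {a : ℕ → ℝ} {σ2 : ℝ} (ha : Tendsto a atTop (𝓝 σ2)) (u : ℝ) :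
    Tendsto (fun k => cexp (-(((a k) * u ^ 2 / 2 : ℝ) : ℂ))) atTop
      (𝓝 (cexp (-((σ2 * u ^ 2 / 2 : ℝ) : ℂ)))) := by
  have h1 : Tendsto (fun k => a k * u ^ 2 / 2) atTop (𝓝 (σ2 * u ^ 2 / 2)) :=
    (ha.mul_const _).div_const _
  exact (Complex.continuous_exp.tendsto _).comp
    ((Complex.continuous_ofReal.tendsto _).comp h1).neg

end Elementary

/-! ## Bernstein blocks: the statistic versus its big-block part -/

section Blocks

variable {Ω : Type*} [MeasurableSpace Ω] {P : Measure Ω} [IsProbabilityMeasure P]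
variable {S : Type*} [MeasurableSpace S] {ξ : ℕ → Ω → S} {m : ℕ} {F : (Fin (m + 1) → S) → ℝ}

/-- **The statistic is `L¹`-close to its big-block part**, at the level of characteristic
functions: for `N ≥ 1`, `k ≥ m`, `p = k + m ≥ 1`,
`‖φ_{S_N/√N}(u) − φ_{(Σ_{j<⌊N/p⌋} U_j)/√N}(u)‖ ≤ |u| (√(v(m)/p) + √((Σ_{r<p} v(r))/N))`. -/
theorem norm_charFun_sub_charFun_bigBlocks_le (hξ : ∀ i, Measurable (ξ i)) (hind : iIndepFun ξ P)
    (hid : ∀ i, IdentDistrib (ξ i) (ξ 0) P P) (hF : Measurable F)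
    (h2 : MemLp (blockFactor F ξ 0) 2 P) {k : ℕ} (hk : m ≤ k) (hp : 0 < k + m) {N : ℕ} (hN : 0 < N)
    (u : ℝ) :
    ‖charFun (P.map fun ω => (Real.sqrt N)⁻¹
          * cblockSum (blockFactor F ξ) (P[blockFactor F ξ 0]) 0 N ω) u
      - charFun (P.map fun ω => (Real.sqrt N)⁻¹
          * ∑ j ∈ range (N / (k + m)),
              cblockSum (blockFactor F ξ) (P[blockFactor F ξ 0]) (j * (k + m) + 0) k ω) u‖
      ≤ |u| * (Real.sqrt (blockVar (fun t => cov[blockFactor F ξ 0, blockFactor F ξ t; P]) m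
            / ((k + m : ℕ) : ℝ))
          + Real.sqrt ((∑ r ∈ range (k + m),
              blockVar (fun t => cov[blockFactor F ξ 0, blockFactor F ξ t; P]) r) / N)) := by
  set μ : ℝ := P[blockFactor F ξ 0] with hμ
  set γ : ℕ → ℝ := fun t => cov[blockFactor F ξ 0, blockFactor F ξ t; P] with hγ
  set p := k + m with hpdef
  set n := N / p with hn
  set SV : Ω → ℝ := fun ω => ∑ j ∈ range n, cblockSum (blockFactor F ξ) μ (j * p + k) m ω with hSV
  set R : Ω → ℝ := cblockSum (blockFactor F ξ) μ (n * p) (N % p) with hR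
  have hmeas : ∀ a r, Measurable (cblockSum (blockFactor F ξ) μ a r) :=
    fun a r => measurable_cblockSum hξ hF μ a r
  have hm2 : ∀ a r, MemLp (cblockSum (blockFactor F ξ) μ a r) 2 P :=
    fun a r => memLp_cblockSum hind hid hF h2 μ a r
  have hZm : Measurable fun ω => (Real.sqrt N)⁻¹ * cblockSum (blockFactor F ξ) μ 0 N ω :=
    (hmeas 0 N).const_mul _
  have hWm : Measurable fun ω => (Real.sqrt N)⁻¹
      * ∑ j ∈ range n, cblockSum (blockFactor F ξ) μ (j * p + 0) k ω :=
    (Finset.measurable_sum _ fun j _ => hmeas _ _).const_mul _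
  have hSV2 : MemLp SV 2 P := memLp_finsetSum _ fun j _ => hm2 _ _
  have hR2 : MemLp R 2 P := hm2 _ _
  -- the difference is `(√N)⁻¹ (SV + R)`
  have hdiff : ∀ ω, (Real.sqrt N)⁻¹ * cblockSum (blockFactor F ξ) μ 0 N ω
      - (Real.sqrt N)⁻¹ * ∑ j ∈ range n, cblockSum (blockFactor F ξ) μ (j * p + 0) k ω
      = (Real.sqrt N)⁻¹ * (SV ω + R ω) := by
    intro ω
    rw [cblockSum_decomposition (blockFactor F ξ) μ k N ω]
    simp only [hSV, hR, hpdef, hn]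
    ring
  have hint : Integrable ((fun ω => (Real.sqrt N)⁻¹ * cblockSum (blockFactor F ξ) μ 0 N ω)
      - fun ω => (Real.sqrt N)⁻¹
        * ∑ j ∈ range n, cblockSum (blockFactor F ξ) μ (j * p + 0) k ω) P := by
    have h : Integrable (fun ω => (Real.sqrt N)⁻¹ * (SV ω + R ω)) P :=
      ((hSV2.add hR2).integrable one_le_two).const_mul _
    refine h.congr (ae_of_all _ fun ω => ?_)
    simp only [Pi.sub_apply, hdiff]
  refine (Literature.Probability.Distributions.norm_charFun_map_sub_le hZm.aemeasurable
    hWm.aemeasurable hint u).trans ?_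
  refine mul_le_mul_of_nonneg_left ?_ (abs_nonneg u)
  simp_rw [hdiff]
  -- `∫ |(√N)⁻¹ (SV + R)| ≤ (√N)⁻¹ (E|SV| + E|R|)`
  have hN0 : (0 : ℝ) ≤ (Real.sqrt N)⁻¹ := inv_nonneg.2 (Real.sqrt_nonneg _)
  have h1 : ∫ ω, |(Real.sqrt N)⁻¹ * (SV ω + R ω)| ∂P
      ≤ (Real.sqrt N)⁻¹ * (∫ ω, |SV ω| ∂P + ∫ ω, |R ω| ∂P) := by
    have e : ∀ ω, |(Real.sqrt N)⁻¹ * (SV ω + R ω)| = (Real.sqrt N)⁻¹ * |SV ω + R ω| := fun ω => by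
      rw [abs_mul, abs_of_nonneg hN0]
    simp_rw [e]
    rw [integral_const_mul, ← integral_add ((hSV2.integrable one_le_two).abs)
      ((hR2.integrable one_le_two).abs)]
    refine mul_le_mul_of_nonneg_left (integral_mono ((hSV2.add hR2).integrable one_le_two).abs
      (((hSV2.integrable one_le_two).abs).add ((hR2.integrable one_le_two).abs))
      fun ω => abs_add_le _ _) hN0
  refine h1.trans ?_
  -- the two second-moment bounds
  have hSV1 : ∫ ω, |SV ω| ∂P ≤ Real.sqrt (n * blockVar γ m) :=
    integral_abs_sum_smallBlocks_le hξ hind hid hF h2 hk n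
  have hR1 : ∫ ω, |R ω| ∂P ≤ Real.sqrt (∑ r ∈ range p, blockVar γ r) :=
    integral_abs_remainder_le hind hid hF h2 (Nat.mod_lt N hp) _
  have hvm : 0 ≤ blockVar γ m := blockVar_nonneg hind hid hF h2 m
  have hNr : (0 : ℝ) < N := Nat.cast_pos.2 hN
  have hpr : (0 : ℝ) < p := Nat.cast_pos.2 hp
  have hnN : (n : ℝ) * p ≤ N := by exact_mod_cast Nat.div_mul_le_self N p
  calc (Real.sqrt N)⁻¹ * (∫ ω, |SV ω| ∂P + ∫ ω, |R ω| ∂P)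
      ≤ (Real.sqrt N)⁻¹ * (Real.sqrt (n * blockVar γ m) + Real.sqrt (∑ r ∈ range p, blockVar γ r)) := by
        gcongr
    _ = Real.sqrt (n * blockVar γ m / N) + Real.sqrt ((∑ r ∈ range p, blockVar γ r) / N) := by
        rw [Real.sqrt_div' _ hNr.le, Real.sqrt_div' _ hNr.le]
        ring
    _ ≤ Real.sqrt (blockVar γ m / p) + Real.sqrt ((∑ r ∈ range p, blockVar γ r) / N) := by
        refine add_le_add_left ?_ _
        refine Real.sqrt_le_sqrt ?_
        -- `n v / N ≤ v / p` since `n p ≤ N`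
        rw [div_le_div_iff₀ hNr hpr]
        nlinarith

/-- **The big blocks obey the i.i.d. central limit theorem.**  With `p = k + m ≥ 1` and
`U_j = Σ_{l<k} (X_{jp+l} − μ)` (i.i.d., centred, variance `v(k)`):
`φ_{(Σ_{j<⌊N/p⌋} U_j)/√N}(u) → exp(−(v(k)/p) u²/2)` as `N → ∞` (Mathlib's CLT along `⌊N/p⌋`, the
deterministic factor `√(⌊N/p⌋/N) → 1/√p` absorbed by the uniform convergence of characteristic
functions along convergent arguments, `Scoring/CharFunArgumentContinuity`). -/
theorem tendsto_charFun_bigBlocks (hξ : ∀ i, Measurable (ξ i)) (hind : iIndepFun ξ P)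
    (hid : ∀ i, IdentDistrib (ξ i) (ξ 0) P P) (hF : Measurable F)
    (h2 : MemLp (blockFactor F ξ 0) 2 P) {k : ℕ} (hp : 0 < k + m) (u : ℝ) :
    Tendsto (fun N : ℕ => charFun (P.map fun ω => (Real.sqrt N)⁻¹
          * ∑ j ∈ range (N / (k + m)),
              cblockSum (blockFactor F ξ) (P[blockFactor F ξ 0]) (j * (k + m) + 0) k ω) u)
      atTop (𝓝 (cexp (-((blockVar (fun t => cov[blockFactor F ξ 0, blockFactor F ξ t; P]) k
          / ((k + m : ℕ) : ℝ) * u ^ 2 / 2 : ℝ) : ℂ)))) := by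
  set μ : ℝ := P[blockFactor F ξ 0] with hμ
  set γ : ℕ → ℝ := fun t => cov[blockFactor F ξ 0, blockFactor F ξ t; P] with hγ
  set p := k + m with hpdef
  set U : ℕ → Ω → ℝ := fun j => cblockSum (blockFactor F ξ) μ (j * p + 0) k with hU
  have hUind : iIndepFun U P :=
    iIndepFun_cblockSum_periodic hξ hind hF μ (n := k) (p := p) (c := 0) le_rfl
  have hUid : ∀ j, IdentDistrib (U j) (U 0) P P := fun j =>
    (identDistrib_cblockSum hind hid hF μ (j * p + 0) k).trans
      (identDistrib_cblockSum hind hid hF μ (0 * p + 0) k).symm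
  have hU2 : MemLp (U 0) 2 P := memLp_cblockSum hind hid hF h2 μ _ k
  have hU0 : P[U 0] = 0 := integral_cblockSum hind hid hF h2 _ k
  have hUvar : Var[U 0; P] = blockVar γ k := variance_cblockSum hind hid hF h2 μ _ k
  have hvk : 0 ≤ blockVar γ k := blockVar_nonneg hind hid hF h2 k
  -- Mathlib's CLT for the big blocks, read along `n = ⌊N/p⌋`
  have T := ProbabilityTheory.tendstoInDistribution_inv_sqrt_mul_sum_sub
    (P' := gaussianReal 0 (Var[U 0; P]).toNNReal) (Y := id) HasLaw.id hU2 hUind hUid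
  have T' : TendstoInDistribution
      (fun N ω => (Real.sqrt (N / p : ℕ))⁻¹ * (∑ j ∈ range (N / p), U j ω - (N / p : ℕ) * P[U 0]))
      atTop id (fun _ => P) (gaussianReal 0 (Var[U 0; P]).toNNReal) :=
    { forall_aemeasurable := fun N => T.forall_aemeasurable (N / p)
      aemeasurable_limit := aemeasurable_id
      tendsto := T.tendsto.comp (Nat.tendsto_div_const_atTop hp.ne') }
  -- the deterministic factor `c_N = √⌊N/p⌋ / √N → √(1/p)`
  set c : ℕ → ℝ := fun N => Real.sqrt (N / p : ℕ) / Real.sqrt N with hc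
  have hcl : Tendsto (fun N => c N * u) atTop (𝓝 (Real.sqrt ((p : ℝ)⁻¹) * u)) := by
    refine Tendsto.mul_const u ?_
    have h := (Real.continuous_sqrt.tendsto _).comp (tendsto_nat_div_div (p := p) hp.ne')
    refine h.congr fun N => ?_
    simp only [hc, Function.comp_apply]
    rw [Real.sqrt_div' _ (Nat.cast_nonneg N)]
  have hlim := CardConsistency.tendsto_charFun_map_of_tendstoInDistribution T' hcl
  -- identify the statistic: `(√N)⁻¹ Σ U_j = c_N · ((√n)⁻¹ (Σ U_j − n·0))`
  have hstat : ∀ N : ℕ, (fun ω => (Real.sqrt N)⁻¹ * ∑ j ∈ range (N / p), U j ω)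
      = fun ω => c N * ((Real.sqrt (N / p : ℕ))⁻¹
          * (∑ j ∈ range (N / p), U j ω - (N / p : ℕ) * P[U 0])) := by
    intro N
    funext ω
    rw [hU0, mul_zero, sub_zero]
    rcases Nat.eq_zero_or_pos (N / p) with h0 | h0
    · simp [h0]
    · have hs : Real.sqrt (N / p : ℕ) ≠ 0 :=
        Real.sqrt_ne_zero'.2 (Nat.cast_pos.2 h0)
      simp only [hc]
      field_simp
  have hcf : ∀ N : ℕ, charFun (P.map fun ω => (Real.sqrt N)⁻¹ * ∑ j ∈ range (N / p), U j ω) u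
      = charFun (P.map fun ω => (Real.sqrt (N / p : ℕ))⁻¹
          * (∑ j ∈ range (N / p), U j ω - (N / p : ℕ) * P[U 0])) (c N * u) := by
    intro N
    rw [hstat N, charFun_map_mul_comp (T'.forall_aemeasurable N)]
  -- identify the limit
  have hA : charFun ((gaussianReal 0 (Var[U 0; P]).toNNReal).map id) (Real.sqrt ((p : ℝ)⁻¹) * u)
      = cexp (-((blockVar γ k / (p : ℝ) * u ^ 2 / 2 : ℝ) : ℂ)) := by
    rw [Measure.map_id, charFun_gaussianReal_zero_mean, hUvar, Real.coe_toNNReal _ hvk]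
    congr 3
    rw [mul_pow, Real.sq_sqrt (by positivity)]
    ring
  rw [hA] at hlim
  exact hlim.congr fun N => (hcf N).symm

end Blocks

/-! ## The theorem -/

section CLT

variable {Ω : Type*} [MeasurableSpace Ω] {P : Measure Ω} [IsProbabilityMeasure P]
variable {Ω' : Type*} [MeasurableSpace Ω'] {P' : Measure Ω'} [IsProbabilityMeasure P']
variable {S : Type*} [MeasurableSpace S] {ξ : ℕ → Ω → S} {m : ℕ} {F : (Fin (m + 1) → S) → ℝ}

/-- **THE CENTRAL LIMIT THEOREM FOR BLOCK FACTORS OF AN I.I.D. SEQUENCE** (the `m`-dependent CLT,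
Hoeffding–Robbins 1948 / Lehmann 1999 Thm 2.8.1 with eq. (2.8.6)).  Let `ξ₀, ξ₁, …` be independent
and identically distributed, `F` measurable on windows of length `m + 1`, `X_i = F(ξ_i, …, ξ_{i+m})`
square integrable, `μ = E X_0`, `γ(t) = cov[X_0, X_t]` and `σ² = γ(0) + 2 Σ_{t=1}^{m} γ(t)` (`≥ 0`,
`lrVar_nonneg`).  Then for every `Y ~ N(0, σ²)`:
`(√N)⁻¹ Σ_{i<N} (X_i − μ) ⇒ Y` in distribution as `N → ∞`. -/
theorem tendstoInDistribution_blockFactor (hξ : ∀ i, Measurable (ξ i)) (hind : iIndepFun ξ P)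
    (hid : ∀ i, IdentDistrib (ξ i) (ξ 0) P P) (hF : Measurable F)
    (h2 : MemLp (blockFactor F ξ 0) 2 P) {Y : Ω' → ℝ}
    (hY : HasLaw Y (gaussianReal 0
      (lrVar (fun t => cov[blockFactor F ξ 0, blockFactor F ξ t; P]) m).toNNReal) P') :
    TendstoInDistribution
      (fun (N : ℕ) ω => (Real.sqrt N)⁻¹ * ∑ i ∈ range N, (blockFactor F ξ i ω - P[blockFactor F ξ 0]))
      atTop Y (fun _ => P) P' := by
  set μ : ℝ := P[blockFactor F ξ 0] with hμ
  set γ : ℕ → ℝ := fun t => cov[blockFactor F ξ 0, blockFactor F ξ t; P] with hγ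
  have hγ0 : ∀ t, m < t → γ t = 0 := fun t ht => covariance_blockFactor_eq_zero hξ hind hid hF h2 ht
  have hσ : 0 ≤ lrVar γ m := lrVar_nonneg hξ hind hid hF h2
  have hZeq : ∀ N : ℕ, (fun ω => (Real.sqrt N)⁻¹ * ∑ i ∈ range N, (blockFactor F ξ i ω - μ))
      = fun ω => (Real.sqrt N)⁻¹ * cblockSum (blockFactor F ξ) μ 0 N ω := by
    intro N
    funext ω
    simp only [cblockSum_apply, zero_add]
  have hZm : ∀ N : ℕ, Measurable fun ω => (Real.sqrt N)⁻¹ * cblockSum (blockFactor F ξ) μ 0 N ω :=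
    fun N => (measurable_cblockSum hξ hF μ 0 N).const_mul _
  refine ⟨fun N => by rw [hZeq N]; exact (hZm N).aemeasurable, hY.aemeasurable, ?_⟩
  rw [ProbabilityMeasure.tendsto_iff_tendsto_charFun]
  intro u
  simp only [ProbabilityMeasure.coe_mk]
  rw [hY.map_eq, charFun_gaussianReal_zero_mean, Real.coe_toNNReal _ hσ]
  -- reduce to the block form of the statistic
  suffices key : Tendsto (fun N : ℕ => charFun (P.map fun ω => (Real.sqrt N)⁻¹
      * cblockSum (blockFactor F ξ) μ 0 N ω) u) atTop (𝓝 (cexp (-((lrVar γ m * u ^ 2 / 2 : ℝ) : ℂ)))) by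
    exact key.congr fun N => by rw [hZeq N]
  -- the two `k → ∞` limits: small blocks vanish, big-block variance per term `→ σ²`
  have hk1 : Tendsto (fun k : ℕ => |u| * Real.sqrt (blockVar γ m / ((k + m : ℕ) : ℝ))) atTop (𝓝 0) := by
    have h1 : Tendsto (fun k : ℕ => blockVar γ m / ((k + m : ℕ) : ℝ)) atTop (𝓝 0) :=
      (tendsto_const_div_atTop_nhds_zero_nat (blockVar γ m)).comp (tendsto_add_atTop_nat m)
    have h2 := (Real.continuous_sqrt.tendsto _).comp h1
    rw [Real.sqrt_zero] at h2
    simpa using h2.const_mul |u|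
  have hk2 : Tendsto (fun k : ℕ => cexp (-((blockVar γ k / ((k + m : ℕ) : ℝ) * u ^ 2 / 2 : ℝ) : ℂ)))
      atTop (𝓝 (cexp (-((lrVar γ m * u ^ 2 / 2 : ℝ) : ℂ)))) := by
    refine tendsto_cexp_neg_mul_sq ?_ u
    have h := tendsto_blockVar_div_add hγ0
    refine h.congr fun k => ?_
    push_cast
    rfl
  refine tendsto_of_forall_approx fun ε hε => ?_
  -- choose the big-block length `k`
  obtain ⟨k, hk1', hk2', hkm, hk1⟩ := ((hk1.eventually (gt_mem_nhds (half_pos hε))).and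
    (((Metric.tendsto_nhds.1 hk2) ε hε).and ((eventually_ge_atTop m).and
      (eventually_ge_atTop 1)))).exists
  have hp : 0 < k + m := by omega
  refine ⟨fun N => charFun (P.map fun ω => (Real.sqrt N)⁻¹
      * ∑ j ∈ range (N / (k + m)),
          cblockSum (blockFactor F ξ) μ (j * (k + m) + 0) k ω) u,
    cexp (-((blockVar γ k / ((k + m : ℕ) : ℝ) * u ^ 2 / 2 : ℝ) : ℂ)),
    tendsto_charFun_bigBlocks hξ hind hid hF h2 hp u, ?_, ?_⟩
  · rw [← dist_eq_norm]; exact hk2'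
  -- eventually `‖f N − g N‖ < ε`
  have hN2 : Tendsto (fun N : ℕ => |u| * Real.sqrt ((∑ r ∈ range (k + m), blockVar γ r) / N))
      atTop (𝓝 0) := by
    have h1 := (Real.continuous_sqrt.tendsto _).comp
      (tendsto_const_div_atTop_nhds_zero_nat (∑ r ∈ range (k + m), blockVar γ r))
    rw [Real.sqrt_zero] at h1
    simpa using h1.const_mul |u|
  filter_upwards [eventually_gt_atTop 0, hN2.eventually (gt_mem_nhds (half_pos hε))] with N hN hN'
  calc _ ≤ |u| * (Real.sqrt (blockVar γ m / ((k + m : ℕ) : ℝ))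
          + Real.sqrt ((∑ r ∈ range (k + m), blockVar γ r) / N)) :=
        norm_charFun_sub_charFun_bigBlocks_le hξ hind hid hF h2 hkm hp hN u
    _ = |u| * Real.sqrt (blockVar γ m / ((k + m : ℕ) : ℝ))
          + |u| * Real.sqrt ((∑ r ∈ range (k + m), blockVar γ r) / N) := by ring
    _ < ε / 2 + ε / 2 := add_lt_add hk1' hN'
    _ = ε := by ring

/-- **Sample-mean form**: `√N (x̄_N − μ) ⇒ Y`, `x̄_N = (1/N) Σ_{i<N} X_i` (same hypotheses). -/
theorem tendstoInDistribution_blockFactor_mean (hξ : ∀ i, Measurable (ξ i)) (hind : iIndepFun ξ P)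
    (hid : ∀ i, IdentDistrib (ξ i) (ξ 0) P P) (hF : Measurable F)
    (h2 : MemLp (blockFactor F ξ 0) 2 P) {Y : Ω' → ℝ}
    (hY : HasLaw Y (gaussianReal 0
      (lrVar (fun t => cov[blockFactor F ξ 0, blockFactor F ξ t; P]) m).toNNReal) P') :
    TendstoInDistribution
      (fun (N : ℕ) ω => Real.sqrt N * ((∑ i ∈ range N, blockFactor F ξ i ω) / N - P[blockFactor F ξ 0]))
      atTop Y (fun _ => P) P' := by
  refine (tendstoInDistribution_blockFactor hξ hind hid hF h2 hY).congr
    (fun N => Eventually.of_forall fun ω => ?_) EventuallyEq.rfl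
  rcases Nat.eq_zero_or_pos N with hN | hN
  · subst hN; simp
  · rw [sum_sub_distrib, sum_const, card_range, nsmul_eq_mul]
    set sN := Real.sqrt (N : ℝ) with hsN
    have hs : sN ≠ 0 := Real.sqrt_ne_zero'.2 (Nat.cast_pos.2 hN)
    have hsq : (N : ℝ) = sN ^ 2 := by rw [hsN, Real.sq_sqrt (Nat.cast_nonneg _)]
    rw [hsq]
    field_simp

end CLT

end Summit.Ventures.LatticeQCDFlow.Scoring

end
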